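import Summits.AtomisticToContinuum.Crystallization.Theorems.FrustratedLawDichotomyStrainedPatchHomCurvCentreLabel
import Summits.AtomisticToContinuum.Crystallization.Theorems.FrustratedLawDichotomyStrainedPatchHomCurvCentreKit2

/-!
# The PER-LABEL second-order floor of the centred curvature leaf, v2 tube (`…HomCurvCentreKit2.dVec2/tube2/nd2S2`)

decomp-a2c hand-1 g27 (crux `AperiodicFrustratedLawGap`, stmt-AtomisticToContinuum-27623; `(H) HomFloor (1/625)`, hcp half; lever (C)).  For a centred
label `b` of the box `(c, w)` with record `cenLabel c w b = some L` (`…HomCurvCentreKit`), every `U, η` in the box and every direction `Δ`: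

  `α(‖c_b‖)⟪c_b,Δ⟫² + β(‖c_b‖)‖Δ‖² ≥ α₀⟪p_b,Δ⟫² + β₀‖Δ‖² + Σ_ij (Σ_k d_b,k D(a₁,α₀,p_b)_k,ij) Δ_iΔ_j − (KS/SC)/2·(nd2/SC)·‖Δ‖²`

with the CANONICAL centre values `α₀ = α(ρ₀) ∈ A0`, `β₀ = β(ρ₀) ∈ B0`, `a₁ = (deriv α)(ρ₀)/ρ₀ ∈ A1q` (`ρ₀ = ‖p_b‖`), where
`c_b = latPt U hexFrame b + U(hcpShift + η)` is the label point, `p_b = cenPt c b` the centre point and `d_b = c_b − p_b`.  Assembled from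
`…HomHessPath.pathForm_secondOrder` on the tube of `…HomCurvCentreKit.tube_mem`, the regime packages of `…HomCurvRegime3`, the enclosures of
`…HomCurvCoeff3` (`kBound_of_mem`) and the algebra of `…HomCurvCentre` (`bracket_eq`, `linForm_eq`, via `floor_core`); one theorem per regime from the
UNBUNDLED per-label data (`label_floor_bump`, `label_floor_lj`: hypotheses = the kernel's `Option` equations), the four facts spelled out.

NO definitions; 0 sorry; standard axioms; no instances / notation / `#eval`.  `--supports stmt-AtomisticToContinuum-27623`.
-/

noncomputable section

namespace Summit.AtomisticToContinuum.Crystallization.Theorems.FrustratedLawDichotomyStrainedPatchHomCurvCentreKit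

open scoped BigOperators RealInnerProductSpace
open Literature.Analysis.ValidatedNumerics.Numerics
open Summit.AtomisticToContinuum.Crystallization.Theorems.ChargedEnergyGapNegative (E3)
open Summit.AtomisticToContinuum.Crystallization.Theorems.FrustratedLawDichotomySchurCut (effPot w₄₅ ω₄)
open Summit.AtomisticToContinuum.Crystallization.Theorems.FrustratedLawDichotomyStrainedPatchHomSplit (latPt hexFrame hcpShift)
open Summit.AtomisticToContinuum.Crystallization.Theorems.FrustratedLawDichotomyStrainedPatchHomEntryGramHcp (dot3 mem_dot3)
open Summit.AtomisticToContinuum.Crystallization.Theorems.FrustratedLawDichotomyStrainedPatchHomCurvCoeff (wFI mem_wFI coeffFI2 mem_coeffFI2 rhoFI mem_rhoFI)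
open Summit.AtomisticToContinuum.Crystallization.Theorems.FrustratedLawDichotomyStrainedPatchHomCurvCoeff3
  (ljTripleFI bumpTripleFI mem_ljTripleFI mem_bumpTripleFI kTermS kBound_of_mem)
open Summit.AtomisticToContinuum.Crystallization.Theorems.FrustratedLawDichotomyStrainedPatchHomCurvRegime3
open Summit.AtomisticToContinuum.Crystallization.Theorems.FrustratedLawDichotomyStrainedPatchHomCurvCentre (bracket_eq linForm_eq)
open Summit.AtomisticToContinuum.Crystallization.Theorems.FrustratedLawDichotomyStrainedPatchHomHessPath (pathForm_secondOrder)
open Summit.AtomisticToContinuum.Crystallization.Theorems.FrustratedLawDichotomyStrainedPatchTaylorLeaves (junctions)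
open Summit.AtomisticToContinuum.Crystallization.Theorems.FrustratedLawDichotomyStrainedPatchTaylorChord (segR)

/-! ## The two regime branches (v2 tube) -/

/-- ★ **Bump branch**. -/
theorem label_floor_bump2 {c w : (Fin 3 × Fin 3) ⊕ Fin 3 → ℤ} {b : Fin 3 → ℤ} (hreg : regBump (tube2 c w b) = true)
    {tt t0 : FI × FI × FI} {ab : FI × FI} {a1q : FI}
    (htt : bumpTripleFI ((tube2 c w b).mul (tube2 c w b)) (wFI (tube2 c w b)) = some tt)
    (ht0 : bumpTripleFI (dot3 (cenVec c b) (cenVec c b)) (wFI (rhoFI (dot3 (cenVec c b) (cenVec c b)))) = some t0)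
    (hab : coeffFI2 (dot3 (cenVec c b) (cenVec c b)) = some ab) (hq : FI.divPos t0.2.1 (dot3 (cenVec c b) (cenVec c b)) = some a1q)
    (U : E3 →L[ℝ] E3)
    (hbox : ∀ ab : Fin 3 × Fin 3, |(U (EuclideanSpace.single ab.2 (1 : ℝ))) ab.1 - (c (Sum.inl ab) : ℝ) / SC| ≤ (w (Sum.inl ab) : ℝ) / SC)
    (η : E3) (hη : ∀ i : Fin 3, |η i - (c (Sum.inr i) : ℝ) / SC| ≤ (w (Sum.inr i) : ℝ) / SC) (Δ : E3) :
    (FI.mem ((deriv (deriv (effPot w₄₅ ω₄ (3 / 400))) ‖cenPt c b‖ - deriv (effPot w₄₅ ω₄ (3 / 400)) ‖cenPt c b‖ / ‖cenPt c b‖) / ‖cenPt c b‖ ^ 2) ab.1 ∧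
      FI.mem (deriv (effPot w₄₅ ω₄ (3 / 400)) ‖cenPt c b‖ / ‖cenPt c b‖) ab.2 ∧
      FI.mem (deriv (fun s => (deriv (deriv (effPot w₄₅ ω₄ (3 / 400))) s - deriv (effPot w₄₅ ω₄ (3 / 400)) s / s) / s ^ 2) ‖cenPt c b‖ /
        ‖cenPt c b‖) a1q ∧
      (deriv (deriv (effPot w₄₅ ω₄ (3 / 400))) ‖cenPt c b‖ - deriv (effPot w₄₅ ω₄ (3 / 400)) ‖cenPt c b‖ / ‖cenPt c b‖) / ‖cenPt c b‖ ^ 2 *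
            ⟪cenPt c b, Δ⟫ ^ 2 + deriv (effPot w₄₅ ω₄ (3 / 400)) ‖cenPt c b‖ / ‖cenPt c b‖ * ‖Δ‖ ^ 2 +
          ∑ i, ∑ j, (∑ k, (latPt U hexFrame b + U (hcpShift + η) - cenPt c b) k *
            Dreal (deriv (fun s => (deriv (deriv (effPot w₄₅ ω₄ (3 / 400))) s - deriv (effPot w₄₅ ω₄ (3 / 400)) s / s) / s ^ 2) ‖cenPt c b‖ /
                ‖cenPt c b‖)
              ((deriv (deriv (effPot w₄₅ ω₄ (3 / 400))) ‖cenPt c b‖ - deriv (effPot w₄₅ ω₄ (3 / 400)) ‖cenPt c b‖ / ‖cenPt c b‖) / ‖cenPt c b‖ ^ 2)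
              (cenPt c b) k i j) * (Δ i * Δ j) -
          ((kTermS tt.1 tt.2.1 tt.2.2) : ℝ) / SC / 2 * ((nd2S2 c w b : ℝ) / SC) * ‖Δ‖ ^ 2 ≤
        (deriv (deriv (effPot w₄₅ ω₄ (3 / 400))) ‖latPt U hexFrame b + U (hcpShift + η)‖ -
            deriv (effPot w₄₅ ω₄ (3 / 400)) ‖latPt U hexFrame b + U (hcpShift + η)‖ / ‖latPt U hexFrame b + U (hcpShift + η)‖) /
            ‖latPt U hexFrame b + U (hcpShift + η)‖ ^ 2 * ⟪latPt U hexFrame b + U (hcpShift + η), Δ⟫ ^ 2 +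
          deriv (effPot w₄₅ ω₄ (3 / 400)) ‖latPt U hexFrame b + U (hcpShift + η)‖ / ‖latPt U hexFrame b + U (hcpShift + η)‖ * ‖Δ‖ ^ 2) := by
  have hS : (0 : ℝ) < SC := by norm_num [SC]
  obtain ⟨hTlo, hThi⟩ := of_decide_eq_true hreg
  set T := tube2 c w b with hT
  set p := cenPt c b with hp
  set cb := latPt U hexFrame b + U (hcpShift + η) with hcb
  set d := cb - p with hd
  set aa : ℝ := (T.lo : ℝ) / SC with haa
  set bb : ℝ := (T.hi : ℝ) / SC with hbb
  have ha : 0 < aa := div_pos (by exact_mod_cast hTlo) hS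
  have hb : bb < 8 / 5 := by
    rw [hbb, div_lt_iff₀ hS]
    have : ((5 * T.hi : ℤ) : ℝ) < ((8 * (SC : ℤ) : ℤ) : ℝ) := by exact_mod_cast hThi
    push_cast at this; linarith
  have hreg' : ∀ r, aa < r → r < bb → 0 < r ∧ r < 8 / 5 := fun r h1 h2 => ⟨ha.trans h1, h2.trans hb⟩
  have htube : ∀ t ∈ Set.Icc (0 : ℝ) 1, aa < segR p d t ∧ segR p d t < bb := fun t ht => by
    have := tube2_mem U hbox η hη b ht
    simpa [segR, hp, hd, hcb] using this
  -- the one-sided second-order expansion on the tube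
  set K : ℝ := (kTermS tt.1 tt.2.1 tt.2.2 : ℝ) / SC with hKdef
  have hPF := pathForm_secondOrder (A := fun s => (deriv (deriv (effPot w₄₅ ω₄ (3 / 400))) s - deriv (effPot w₄₅ ω₄ (3 / 400)) s / s) / s ^ 2)
    (A₁ := alpha1B) (A₂ := alpha2B) (B := fun s => deriv (effPot w₄₅ ω₄ (3 / 400)) s / s) (B₁ := fun s => alphaB s * s)
    (B₂ := fun s => alpha1B s * s + alphaB s) (K := K) (p := p) (d := d) (Δ := Δ) ha htube
    (fun r h1 h2 => hasDerivAt_alphaTrue_bump (hreg' r h1 h2).1 (hreg' r h1 h2).2)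
    (fun r h1 h2 => hasDerivAt_alpha1B (hreg' r h1 h2).1.ne')
    (fun r h1 h2 => hasDerivAt_betaTrue_bump (hreg' r h1 h2).1 (hreg' r h1 h2).2)
    (fun r h1 h2 => hasDerivAt_alphaB_mul (hreg' r h1 h2).1.ne')
    (fun r h1 h2 => by
      have hr := hreg' r h1 h2
      have hmT : FI.mem r T := mem_of_strict h1 h2
      have hq2 : FI.mem (r ^ 2) (T.mul T) := by rw [sq]; exact FI.mem_mul hmT hmT
      obtain ⟨m0, m1, m2⟩ := mem_bumpTripleFI hq2 (mem_wFI hmT) htt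
      have key := kBound_of_mem hr.1 m0 m1 m2
      simp only [alphaTrue_eq_bump hr.1 hr.2]
      exact key)
  -- centre data
  have h0t := htube 0 (by simp)
  have hR0 : segR p d 0 = ‖p‖ := by simp [segR]
  rw [hR0] at h0t
  have hρr := hreg' ‖p‖ h0t.1 h0t.2
  have hρne : ‖p‖ ≠ 0 := hρr.1.ne'
  have hJ : ‖p‖ ∉ junctions := not_mem_junctions_of (Or.inl hρr)
  have hQ0 := (mem_rho0 c b).1
  have hRho := (mem_rho0 c b).2
  have hcoef := mem_coeffFI2 hρr.1 hJ hQ0 hab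
  obtain ⟨_, m1c, _⟩ := mem_bumpTripleFI hQ0 (mem_wFI hRho) ht0
  have ha1 : FI.mem (alpha1B ‖p‖ / ‖p‖) a1q := by
    have := FI.mem_divPos hq m1c hQ0
    have e : alpha1B ‖p‖ * ‖p‖ / ‖p‖ ^ 2 = alpha1B ‖p‖ / ‖p‖ := by field_simp
    rw [← e]; exact this
  have hlink0 : (deriv (deriv (effPot w₄₅ ω₄ (3 / 400))) ‖p‖ - deriv (effPot w₄₅ ω₄ (3 / 400)) ‖p‖ / ‖p‖) / ‖p‖ ^ 2 = alphaB ‖p‖ :=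
    alphaTrue_eq_bump hρr.1 hρr.2
  have hder : deriv (fun s => (deriv (deriv (effPot w₄₅ ω₄ (3 / 400))) s - deriv (effPot w₄₅ ω₄ (3 / 400)) s / s) / s ^ 2) ‖p‖ = alpha1B ‖p‖ :=
    (hasDerivAt_alphaTrue_bump hρr.1 hρr.2).deriv
  refine ⟨hcoef.1, hcoef.2, by rw [hder]; exact ha1, ?_⟩
  rw [hder]
  have hpd : p + d = cb := by rw [hd]; abel
  simp only [hpd] at hPF
  rw [← hlink0] at hPF
  have hK0 : 0 ≤ K := div_nonneg (by exact_mod_cast kTermS_nonneg _ _ _) hS.le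
  have hN : ‖d‖ ^ 2 ≤ (nd2S2 c w b : ℝ) / SC := by
    rw [le_div_iff₀ hS]; exact norm_sq_dVec2_le U hbox η hη b
  have := floor_core p d Δ hρne hK0 hN hPF
  simpa [hKdef] using this

/-- ★ **Lennard-Jones branch**. -/
theorem label_floor_lj2 {c w : (Fin 3 × Fin 3) ⊕ Fin 3 → ℤ} {b : Fin 3 → ℤ} (hreg : regLJ (tube2 c w b) = true)
    {tt t0 : FI × FI × FI} {ab : FI × FI} {a1q : FI}
    (htt : ljTripleFI ((tube2 c w b).mul (tube2 c w b)) = some tt)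
    (ht0 : ljTripleFI (dot3 (cenVec c b) (cenVec c b)) = some t0)
    (hab : coeffFI2 (dot3 (cenVec c b) (cenVec c b)) = some ab) (hq : FI.divPos t0.2.1 (dot3 (cenVec c b) (cenVec c b)) = some a1q)
    (U : E3 →L[ℝ] E3)
    (hbox : ∀ ab : Fin 3 × Fin 3, |(U (EuclideanSpace.single ab.2 (1 : ℝ))) ab.1 - (c (Sum.inl ab) : ℝ) / SC| ≤ (w (Sum.inl ab) : ℝ) / SC)
    (η : E3) (hη : ∀ i : Fin 3, |η i - (c (Sum.inr i) : ℝ) / SC| ≤ (w (Sum.inr i) : ℝ) / SC) (Δ : E3) :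
    (FI.mem ((deriv (deriv (effPot w₄₅ ω₄ (3 / 400))) ‖cenPt c b‖ - deriv (effPot w₄₅ ω₄ (3 / 400)) ‖cenPt c b‖ / ‖cenPt c b‖) / ‖cenPt c b‖ ^ 2) ab.1 ∧
      FI.mem (deriv (effPot w₄₅ ω₄ (3 / 400)) ‖cenPt c b‖ / ‖cenPt c b‖) ab.2 ∧
      FI.mem (deriv (fun s => (deriv (deriv (effPot w₄₅ ω₄ (3 / 400))) s - deriv (effPot w₄₅ ω₄ (3 / 400)) s / s) / s ^ 2) ‖cenPt c b‖ /
        ‖cenPt c b‖) a1q ∧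
      (deriv (deriv (effPot w₄₅ ω₄ (3 / 400))) ‖cenPt c b‖ - deriv (effPot w₄₅ ω₄ (3 / 400)) ‖cenPt c b‖ / ‖cenPt c b‖) / ‖cenPt c b‖ ^ 2 *
            ⟪cenPt c b, Δ⟫ ^ 2 + deriv (effPot w₄₅ ω₄ (3 / 400)) ‖cenPt c b‖ / ‖cenPt c b‖ * ‖Δ‖ ^ 2 +
          ∑ i, ∑ j, (∑ k, (latPt U hexFrame b + U (hcpShift + η) - cenPt c b) k *
            Dreal (deriv (fun s => (deriv (deriv (effPot w₄₅ ω₄ (3 / 400))) s - deriv (effPot w₄₅ ω₄ (3 / 400)) s / s) / s ^ 2) ‖cenPt c b‖ /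
                ‖cenPt c b‖)
              ((deriv (deriv (effPot w₄₅ ω₄ (3 / 400))) ‖cenPt c b‖ - deriv (effPot w₄₅ ω₄ (3 / 400)) ‖cenPt c b‖ / ‖cenPt c b‖) / ‖cenPt c b‖ ^ 2)
              (cenPt c b) k i j) * (Δ i * Δ j) -
          ((kTermS tt.1 tt.2.1 tt.2.2) : ℝ) / SC / 2 * ((nd2S2 c w b : ℝ) / SC) * ‖Δ‖ ^ 2 ≤
        (deriv (deriv (effPot w₄₅ ω₄ (3 / 400))) ‖latPt U hexFrame b + U (hcpShift + η)‖ -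
            deriv (effPot w₄₅ ω₄ (3 / 400)) ‖latPt U hexFrame b + U (hcpShift + η)‖ / ‖latPt U hexFrame b + U (hcpShift + η)‖) /
            ‖latPt U hexFrame b + U (hcpShift + η)‖ ^ 2 * ⟪latPt U hexFrame b + U (hcpShift + η), Δ⟫ ^ 2 +
          deriv (effPot w₄₅ ω₄ (3 / 400)) ‖latPt U hexFrame b + U (hcpShift + η)‖ / ‖latPt U hexFrame b + U (hcpShift + η)‖ * ‖Δ‖ ^ 2) := by
  have hS : (0 : ℝ) < SC := by norm_num [SC]
  obtain ⟨hTlo, hThi⟩ := of_decide_eq_true hreg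
  set T := tube2 c w b with hT
  set p := cenPt c b with hp
  set cb := latPt U hexFrame b + U (hcpShift + η) with hcb
  set d := cb - p with hd
  set aa : ℝ := (T.lo : ℝ) / SC with haa
  set bb : ℝ := (T.hi : ℝ) / SC with hbb
  have ha8 : 8 / 5 < aa := by
    rw [haa, lt_div_iff₀ hS]
    have : ((8 * (SC : ℤ) : ℤ) : ℝ) < ((5 * T.lo : ℤ) : ℝ) := by exact_mod_cast hTlo
    push_cast at this; linarith
  have ha : 0 < aa := lt_trans (by norm_num) ha8
  have hb : bb < 3 := by
    rw [hbb, div_lt_iff₀ hS]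
    have : ((T.hi : ℤ) : ℝ) < ((3 * (SC : ℤ) : ℤ) : ℝ) := by exact_mod_cast hThi
    push_cast at this; linarith
  have hreg' : ∀ r, aa < r → r < bb → 8 / 5 < r ∧ r < 3 := fun r h1 h2 => ⟨ha8.trans h1, h2.trans hb⟩
  have htube : ∀ t ∈ Set.Icc (0 : ℝ) 1, aa < segR p d t ∧ segR p d t < bb := fun t ht => by
    have := tube2_mem U hbox η hη b ht
    simpa [segR, hp, hd, hcb] using this
  -- the one-sided second-order expansion on the tube
  set K : ℝ := (kTermS tt.1 tt.2.1 tt.2.2 : ℝ) / SC with hKdef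
  have hPF := pathForm_secondOrder (A := fun s => (deriv (deriv (effPot w₄₅ ω₄ (3 / 400))) s - deriv (effPot w₄₅ ω₄ (3 / 400)) s / s) / s ^ 2)
    (A₁ := alpha1LJ) (A₂ := alpha2LJ) (B := fun s => deriv (effPot w₄₅ ω₄ (3 / 400)) s / s) (B₁ := fun s => alphaLJ s * s)
    (B₂ := fun s => alpha1LJ s * s + alphaLJ s) (K := K) (p := p) (d := d) (Δ := Δ) ha htube
    (fun r h1 h2 => hasDerivAt_alphaTrue_lj (hreg' r h1 h2).1 (hreg' r h1 h2).2)
    (fun r h1 h2 => hasDerivAt_alpha1LJ (by linarith [(hreg' r h1 h2).1] : r ≠ 0))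
    (fun r h1 h2 => hasDerivAt_betaTrue_lj (hreg' r h1 h2).1 (hreg' r h1 h2).2)
    (fun r h1 h2 => hasDerivAt_alphaLJ_mul (by linarith [(hreg' r h1 h2).1] : r ≠ 0))
    (fun r h1 h2 => by
      have hr := hreg' r h1 h2
      have hmT : FI.mem r T := mem_of_strict h1 h2
      have hq2 : FI.mem (r ^ 2) (T.mul T) := by rw [sq]; exact FI.mem_mul hmT hmT
      obtain ⟨m0, m1, m2⟩ := mem_ljTripleFI hq2 htt
      have hr0 : 0 < r := lt_trans (by norm_num) hr.1
      have key := kBound_of_mem hr0 m0 m1 m2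
      simp only [alphaTrue_eq_lj hr.1 hr.2]
      exact key)
  -- centre data
  have h0t := htube 0 (by simp)
  have hR0 : segR p d 0 = ‖p‖ := by simp [segR]
  rw [hR0] at h0t
  have hρr := hreg' ‖p‖ h0t.1 h0t.2
  have hρpos : 0 < ‖p‖ := lt_trans (by norm_num) hρr.1
  have hρne : ‖p‖ ≠ 0 := hρpos.ne'
  have hJ : ‖p‖ ∉ junctions := not_mem_junctions_of (Or.inr hρr)
  have hQ0 := (mem_rho0 c b).1
  have hcoef := mem_coeffFI2 hρpos hJ hQ0 hab
  obtain ⟨_, m1c, _⟩ := mem_ljTripleFI hQ0 ht0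
  have ha1 : FI.mem (alpha1LJ ‖p‖ / ‖p‖) a1q := by
    have := FI.mem_divPos hq m1c hQ0
    have e : alpha1LJ ‖p‖ * ‖p‖ / ‖p‖ ^ 2 = alpha1LJ ‖p‖ / ‖p‖ := by field_simp
    rw [← e]; exact this
  have hlink0 : (deriv (deriv (effPot w₄₅ ω₄ (3 / 400))) ‖p‖ - deriv (effPot w₄₅ ω₄ (3 / 400)) ‖p‖ / ‖p‖) / ‖p‖ ^ 2 = alphaLJ ‖p‖ :=
    alphaTrue_eq_lj hρr.1 hρr.2
  have hder : deriv (fun s => (deriv (deriv (effPot w₄₅ ω₄ (3 / 400))) s - deriv (effPot w₄₅ ω₄ (3 / 400)) s / s) / s ^ 2) ‖p‖ = alpha1LJ ‖p‖ :=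
    (hasDerivAt_alphaTrue_lj hρr.1 hρr.2).deriv
  refine ⟨hcoef.1, hcoef.2, by rw [hder]; exact ha1, ?_⟩
  rw [hder]
  have hpd : p + d = cb := by rw [hd]; abel
  simp only [hpd] at hPF
  rw [← hlink0] at hPF
  have hK0 : 0 ≤ K := div_nonneg (by exact_mod_cast kTermS_nonneg _ _ _) hS.le
  have hN : ‖d‖ ^ 2 ≤ (nd2S2 c w b : ℝ) / SC := by
    rw [le_div_iff₀ hS]; exact norm_sq_dVec2_le U hbox η hη b
  have := floor_core p d Δ hρne hK0 hN hPF
  simpa [hKdef] using this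

end Summit.AtomisticToContinuum.Crystallization.Theorems.FrustratedLawDichotomyStrainedPatchHomCurvCentreKit

end
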